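import Summits.Ventures.KdS.RouteWSpinFlipStrata
import Summits.Ventures.KdS.RouteWSpinFlipResidual
import Summits.Ventures.KdS.RouteWDoublyResonantCandidate
import Summits.Ventures.KdS.RouteWDoublyResonantNoStatic
import Summits.Ventures.KdS.RouteWRealAxisNoRay
import HarnessLib

/-!
# Venture KdS — the typed residual `RouteW.NonExtremeStrata` is a theorem: Casals–Teixeira da
# Costa's Proposition 3.8 WITHOUT the pair condition `p₁`

HONEST FRAMING (venture `Summits/Ventures/KdS`, cell `pub-kds`; optional kernel object of the
Monday S3 seat, composing `RouteWSpinFlipStrata` (LIT-1 g22), `RouteWSpinFlipResidual` (P1 g5: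
the typed residual) and the doubly-resonant series `RouteWDoublyResonant{Comparison, …, Assembly,
Candidate}` (P1 g11–g13; T10 of `lit/Q3PRIME-CASES.md`)). STRUCTURE §8 Q3 asked whether CTdC
Prop. 3.8's pair condition `p₁ = PairCondition(s − 2η₁)` is NECESSARY for its conclusion;
`RouteWSpinFlipStrata` proved the conclusion everywhere except at the DOUBLY-RESONANT lattice
points `Re ω = mϖ₁`, `2η₁ − s = −(i₀ + 1)` (`i₀ ∈ ℕ`), where polynomial Euler-gauge candidates of
degree `D − 1 − i₀` survive the formal-Euler-partner argument, and T10 proved that every such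
polynomial candidate violates the angular half-line hypothesis `Im(λ̄ω̄) ≤ 0`. This file glues the
two: `radial_vanishing_lattice_eventRay` re-runs the partner argument of `radial_vanishing_lattice`
ON the event ray — off the resonances `2η₁ − s ∉ −ℕ₊` no weight vanishes; at a resonance the
partner coefficients kill the Frobenius coefficients `a_k`, `k ≤ i₀`
(`partnerWeight_ne_zero_of_lt`), so `r = X^{i₀+1}ũ` (`coeff_eq_zero_of_shiftPoly_coeff_eq_zero`),
the stratum data force `a ≠ 0`, `m = 0`, `ω = iy` (`a_ne_zero_of_resonance`,
`eq_zero_of_two_rays`), and `im_lambdaBar_mul_conj_pos_of_hatsuda` (reverse F-homotopy + T10)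
contradicts `Im(λ̄ω̄) ≤ 0` unless `ũ = 0`. Hence ★ `nonExtremeStrata_holds : NonExtremeStrata` —
§8 Q3 answered «NO, `p₁` is not needed for the conclusion» as a kernel theorem, for the
GENERIC-BULLET boundary predicates `IsIngoingAtEventHorizon` / `IsOutgoingAtCosmoHorizon` (on
the event-threshold ray `Re ω = mϖ₁` the typed generic-bullet event-horizon predicate differs from
the printed special bullet of CTdC Def. 3.3 (REFEREE #451 (8)); the statements here concern the
typed predicates; nothing is claimed about the printed special-bullet modes on that ray) — and
`prop38_without_p₁` restates it with H3's binders minus `p₁`. Nothing here is a statement about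
physical quasinormal modes, nonlinear stability or the Final State Conjecture. 0 facts, no `sorry`.
-/

noncomputable section

open Set Complex Filter Topology Finset Polynomial

namespace Summit.Ventures.KdS

namespace RouteW

open Literature.Analysis.ODE Literature.Analysis.ODE.GeneralHeun
open Literature.Geometry.Lorentzian Literature.Geometry.Lorentzian.KerrDeSitter
open SpinFlipTS DoublyResonant

/-! ### The lattice strata ON the event threshold ray -/

/-- **CTdC Prop. 3.8's conclusion at every point of the cosmological lattice ON the event threshold
ray `Re ω = mϖ₁`** (the case `radial_vanishing_lattice` excludes): subextremal, `0 ≤ a`,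
`2s = N ≥ 1`, `Im ω > 0`, `Im(λ̄ω̄) ≤ 0`, `|ω| ∉ |m|(0,Ω_SR)`, `p₃`, `Re ω = mϖ₁`,
`s + 2B(r_c) = j ∈ ℕ`, `j + 1 ≤ N` ⇒ every generic-boundary radial Teukolsky solution vanishes on
`(r₊, r_c)`. Steps (0)–(4) = `radial_vanishing_lattice` (`b ≡ 0`); then either no weight vanishes
(`2η₁ − s ∉ −ℕ₊`, `a ≡ 0` as there) or `2η₁ − s = −(i₀+1)`: `a_k = 0` for `k ≤ i₀`, `r = X^{i₀+1}ũ`,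
the stratum is doubly resonant (`m = 0`, `ω = iy`, `a ≠ 0`) and T10
(`im_lambdaBar_mul_conj_pos_of_hatsuda`) forces `ũ = 0`. PROVED, 0 cited facts. -/
theorem radial_vanishing_lattice_eventRay {M a Λ s : ℝ} {ω : ℂ} {m : ℝ} {lam : ℂ} {R : ℝ → ℂ}
    (hsub : IsSubextremal M a Λ) (ha : 0 ≤ a) {N : ℕ} (hN1 : 1 ≤ N) (hsN : 2 * s = N)
    (hω : 0 < ω.im) (hlam : (lambdaBar a Λ s ω m lam * (starRingEnd ℂ) ω).im ≤ 0)
    (hSR : ¬(0 < ‖ω‖ ∧ ‖ω‖ < |m| * superradiantUpper M a Λ))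
    (hp₃ : PairCondition (-2 * (etaEvent M a Λ ω m + etaCauchy M a Λ ω m)))
    (hray : ω.re = m * horizonAngVel a (rPlus M a Λ))
    {j : ℕ} (hjN : j + 1 ≤ N) (hlat : (s : ℂ) + 2 * horizonB M a Λ ω m (rCosmo M a Λ) = (j : ℂ))
    (hR : IsRadialTeukolskySolution M a Λ s ω m lam R) (hin : IsIngoingAtEventHorizon M a Λ s ω m R)
    (hout : IsOutgoingAtCosmoHorizon M a Λ ω m R) :
    ∀ r ∈ Ioo (rPlus M a Λ) (rCosmo M a Λ), R r = 0 := by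
  -- (0) the spin-flip image vanishes by route W; the Hatsuda function is `x^{1−γ}(z_r−x)^{1−ε}·r`
  obtain ⟨R', hR', hin', hout', hpoly⟩ :=
    spinFlip_polynomial M a Λ s ω m lam R N hsub hN1 hsN hR hin hout
  have hN' : (1 : ℝ) ≤ N := by exact_mod_cast hN1
  have hs' : -s < 1 := by linarith
  have hlam' : (lambdaBar a Λ (-s) ω m (lamFlip a Λ s lam) * (starRingEnd ℂ) ω).im ≤ 0 := by
    rw [lambdaBar_lamFlip]; exact hlam
  have hR'0 := radial_vanishing_lt_one hsub ha hs' hω hlam' hSR hp₃ hR' hin' hout'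
  obtain ⟨r, hrdeg, hyr⟩ := hpoly hR'0 j hjN hlat
  -- abbreviations
  set η₀ := etaCauchy M a Λ ω m with hη₀
  set η₁ := etaEvent M a Λ ω m with hη₁
  set η₂ := etaCosmo M a Λ ω m with hη₂
  set z₂ := zTwo M a Λ with hz₂def
  set zr := mobiusZr M a Λ with hzrdef
  have hz₂ : 1 < z₂ := one_lt_zTwo hsub
  have hzr1 : 1 < zr := one_lt_mobiusZr hsub; have hzr0 : 0 < zr := by linarith
  have hA' : zr / (zr - 1) = z₂ := mobiusA_mobiusZr hsub
  set D : ℕ := N - 1 - j with hDdef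
  have hDj : D + j + 1 = N := by omega
  have hrD : r.natDegree ≤ D := by omega
  set y : ℝ → ℂ := fun x => R (mobiusInv M a Λ x) / heunWeight M a Λ s ω m (mobiusInv M a Λ x)
    with hy
  -- (1) the Euler-gauge equation for `v = z^{−σ₋} y(z_r(z−1)/z)` on `(1, z₂)`
  have hysol := heunSolution_of_isRadialTeukolskySolution hsub hR
  have hV : ∀ z ∈ Ioo 1 z₂, 0 < z ∧ mobiusX zr z ∈ Ioo (0 : ℝ) 1 := by
    intro z hz
    obtain ⟨hz1, hzz⟩ := hz
    have hz0 : 0 < z := by linarith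
    refine ⟨hz0, ?_, ?_⟩
    · unfold mobiusX
      exact div_pos (mul_pos hzr0 (by linarith)) hz0
    · unfold mobiusX
      rw [← hA'] at hzz; rw [div_lt_one hz0]
      have h1 : z * (zr - 1) < zr := (lt_div_iff₀ (by linarith)).mp hzz
      nlinarith
  have hmob := isSolutionOn_mobius (heun_fuchs hsub s ω m) (ne_of_gt hzr1) hV hysol
  rw [accessoryIdentity_holds M a Λ s ω m lam hsub, mobiusβ_eq hsub, mobiusγ_eq hsub,
    heunGamma_eq hsub, heunDelta_eq hsub, heunSigmaMinus_eq hsub, hzrdef, mobiusA_mobiusZr hsub]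
    at hmob
  -- the Euler-gauge parameters
  set m₁ := mass₁ M a Λ s ω m with hm₁
  set m₂ := mass₂ M a Λ ω m with hm₂
  set m₃ := mass₃ M a Λ s ω m with hm₃
  set m₄ := mass₄ M a Λ ω m with hm₄
  set E := bigE M a Λ s ω m lam with hE
  set ρ : ℂ := 2 * η₁ - (s : ℂ) with hρdef
  set η : ℂ := eulerGaugeα m₂ m₃ with hηdef
  have hF := eulerGauge_fuchs m₁ m₂ m₃ m₄
  have hroot : (η - eulerGaugeα m₂ m₃) * (η - eulerGaugeβ m₂ m₄) = 0 := by rw [hηdef]; ring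
  have hρ : ρ = 1 - eulerGaugeδ m₁ m₂ := by
    rw [hm₁, hm₂]; unfold mass₁ mass₂; rw [eulerGaugeδ_eta]; ring
  have hηval : η = 1 + (s : ℂ) + 2 * η₀ := by
    rw [hηdef, hm₂, hm₃]; unfold mass₂ mass₃; rw [eulerGaugeα_eta]
  -- (2) the explicit Frobenius-polynomial form of `v` on `(1, z₂)`
  set c₀ : ℂ := eulerKernel (heunGamma M a Λ s ω m + heunEps M a Λ s ω m - 2) zr with hc₀
  set A : Polynomial ℂ := shiftPoly zr D r with hAdef
  set aC : ℕ → ℂ := fun k => c₀ * A.coeff k with haC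
  have hAdeg : A.natDegree ≤ D := shiftPoly_natDegree_le zr D r
  have hκ : heunGamma M a Λ s ω m + heunEps M a Λ s ω m - 2 - heunSigmaMinus M a Λ s ω m =
      (D : ℂ) := by
    have hFH := heun_fuchs hsub s ω m
    have hσ : heunSigmaPlus s = (N : ℂ) + 1 := by
      have := two_sub_sigmaPlus s hsN; linear_combination -this
    have hδ : heunDelta M a Λ s ω m = (j : ℂ) + 1 := by
      have := delta_sub_one M a Λ s ω m; rw [hlat] at this; linear_combination this
    have hDc : (D : ℂ) = (N : ℂ) - 1 - (j : ℂ) := by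
      have : ((D + j + 1 : ℕ) : ℂ) = (N : ℂ) := by rw [hDj]
      push_cast at this; linear_combination this
    rw [hDc]; linear_combination hFH + hσ - hδ
  have hκ' : heunGamma M a Λ s ω m + heunEps M a Λ s ω m - 2 - η = (D : ℂ) := by
    rw [hηdef, hm₂, hm₃, ← heunSigmaMinus_eq hsub s ω m]; exact hκ
  have hγρ : 1 - heunGamma M a Λ s ω m = ρ := by rw [hρdef, hη₁]; exact one_sub_heunGamma hsub s ω m
  have hv_eq : ∀ w ∈ Ioo 1 z₂, mobiusV zr η y w = cpowSum ρ aC (D + 1) w := by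
    intro w hw
    obtain ⟨-, hx⟩ := hV w hw
    rw [mobiusV_eq_cpow_mul_eval hzr0 hrD hκ' hyr hw.1 hx, hγρ]
    exact cpow_mul_eval_eq_cpowSum hAdeg c₀ ρ hw.1
  have hsolF : IsSolutionOn (z₂ : ℂ) (eulerGaugeα m₂ m₃) (eulerGaugeβ m₂ m₄) (eulerGaugeγ m₁ m₂)
      (eulerGaugeδ m₁ m₂) (eulerGaugeε m₃ m₄) (eulerGaugeQ m₁ m₂ m₃ m₄ E (z₂ : ℂ)) (Ioo 1 z₂)
      (cpowSum ρ aC (D + 1)) :=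
    SpinFlipTS.IsSolutionOn.congr_eqOn isOpen_Ioo hmob fun w hw => hv_eq w hw
  -- (3) the formal Euler partner solves the swapped equation
  have haC0 : ∀ k, D < k → aC k = 0 := by
    intro k hk
    simp only [haC]
    rw [coeff_eq_zero_of_natDegree_lt (lt_of_le_of_lt hAdeg hk), mul_zero]
  set b : ℕ → ℂ := partnerCoeff ρ η D aC with hbdef
  set ρt : ℂ := 2 * (η₀ + η₁) with hρt
  have hρt' : ρ + η - 1 = ρt := by rw [hηval, hρdef, hρt]; ring
  have hpart := isSolutionOn_partner hz₂ hF hroot hρ haC0 hsolF z₂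
  rw [hηdef, euler_swap_α, euler_swap_β, euler_swap_γ, euler_swap_δ, euler_swap_ε, euler_swap_q,
    ← hηdef, hρt'] at hpart
  -- (4) mode data of the partner, gauge glue, energy identity
  have hdata := heunModeData_cpowSum hz₂ hpart
  obtain ⟨Rt, hRt, hRtinj⟩ := gaugeGlue_holds z₂ m₁ m₃ m₂ m₄ E ρt _ hz₂ hdata
  have he₁ : ρt + eulerGaugeδ m₁ m₃ / 2 = 1 / 2 + etaCauchy M a Λ ω m + etaEvent M a Λ ω m := by
    rw [hm₁, hm₃]; unfold mass₁ mass₃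
    rw [eulerGaugeδ_swap_eta, hρt, hη₀, hη₁]; ring
  have he₂ : eulerGaugeε m₂ m₄ / 2 = 1 / 2 - etaCauchy M a Λ ω m - etaCosmo M a Λ ω m := by
    rw [hm₂, hm₄]; unfold mass₂ mass₄
    rw [eulerGaugeε_swap_eta]; ring
  rw [he₁, he₂] at hRt
  obtain ⟨hM, hΛ, h01, h12, -⟩ := id hsub
  have hr₀ : 0 ≤ rMinus M a Λ := rMinus_nonneg M a Λ
  have hcoef : ∀ z ∈ Ioo 1 z₂,
      sqcdCoeff m₁ m₃ m₂ m₄ E (z₂ : ℂ) z = tildeCoeff M a Λ s ω m lam z := by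
    intro z hz
    obtain ⟨hz1, hzz⟩ := hz
    rw [hm₁, hm₂, hm₃, hm₄, hE]
    unfold tildeCoeff bigE mass₁ mass₂ mass₃ mass₄
    rw [hz₂def] at hzz ⊢
    unfold zTwo
    symm
    refine ctdcTilde_eq_sqcd_swap (s : ℂ) η₀ η₁ η₂ (ltBlock M a Λ s ω m lam) ?_ ?_ ?_ ?_ ?_ ?_ ?_
    · exact_mod_cast (sub_pos.mpr h01).ne'
    · have : 0 < rCosmo M a Λ + (rMinus M a Λ + rPlus M a Λ + rCosmo M a Λ) := by linarith
      exact_mod_cast this.ne'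
    · have : 0 < rPlus M a Λ + rCosmo M a Λ := by linarith
      exact_mod_cast this.ne'
    · have : (0 : ℝ) < z := by linarith
      exact_mod_cast this.ne'
    · exact sub_ne_zero.mpr (by exact_mod_cast (ne_of_gt hz1))
    · unfold zTwo at hzz
      exact sub_ne_zero.mpr (by exact_mod_cast (ne_of_gt hzz))
    · rw [hz₂def] at hz₂
      unfold zTwo at hz₂
      have : (0 : ℝ) < ctdcZ₂ (rMinus M a Λ) (rPlus M a Λ) (rCosmo M a Λ) := by linarith
      exact_mod_cast this.ne'
  have hRt' : NormalFormModeData z₂ (tildeCoeff M a Λ s ω m lam)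
      (1 / 2 + etaCauchy M a Λ ω m + etaEvent M a Λ ω m)
      (1 / 2 - etaCauchy M a Λ ω m - etaCosmo M a Λ ω m) Rt := hRt.congr hcoef
  have hRt0 := swappedEnergyVanishing_holds M a Λ s ω m lam Rt hsub ha hω hlam hSR hRt'
  have hvt0 : ∀ w ∈ Ioo 1 z₂, cpowSum ρt b (D + 1) w = 0 := hRtinj hRt0
  -- (5) `b ≡ 0`; the second family of weights does not vanish (`p₃`)
  have hb0 := coeff_eq_zero_of_cpowSum_eq_zero hz₂ hvt0
  have hκ₂ := surfaceGravity_rCosmo_pos hsub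
  have h2 : ∀ i : ℕ, ρ + η + i ≠ 0 := by
    intro i h
    have hnr := nonres_of_pairCondition (η₀ := η₀) (η₁ := η₁) (by rw [hη₀, hη₁]; exact hp₃) i
    apply hnr
    rw [hηval, hρdef] at h
    linear_combination h
  -- the lattice datum, real and imaginary parts: `Im ω = (j − s)κ₂`, `Re ω = mϖ₂`
  have hlatR : (s : ℂ) + 2 * horizonB M a Λ ω m (rCosmo M a Λ) = ((j : ℝ) : ℂ) := by
    rw [Complex.ofReal_natCast]; exact hlat
  obtain ⟨hyc, hray₂⟩ := im_re_of_lattice hsub hlatR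
  -- KEY: every Frobenius coefficient vanishes
  have ha0 : ∀ k, aC k = 0 := by
    by_cases hres : ∃ i₀ : ℕ, ρ + 1 + (i₀ : ℂ) = 0
    · -- the doubly-resonant case `ρ = −(i₀ + 1)`
      obtain ⟨i₀, hi₀⟩ := hres
      have h1lt : ∀ i : ℕ, i < i₀ → ρ + 1 + (i : ℂ) ≠ 0 := by
        intro i hi h
        have : (i : ℂ) = (i₀ : ℂ) := by linear_combination h - hi₀
        have : i = i₀ := by exact_mod_cast this
        omega
      -- `a_k = 0` for `k ≤ i₀`: these weights do not vanish
      have hlow : ∀ k, k < i₀ + 1 → aC k = 0 := by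
        intro k hk
        by_cases hkD : k < D + 1
        · exact (mul_eq_zero.mp (hb0 k hkD)).resolve_right
            (partnerWeight_ne_zero_of_lt (fun i hi => h1lt i (by omega)) h2 D)
        · exact haC0 k (by omega)
      by_contra hne
      push Not at hne
      obtain ⟨k₁, hk₁⟩ := hne
      have hk₁D : k₁ ≤ D := by
        by_contra h; exact hk₁ (haC0 k₁ (by omega))
      have hk₁i : i₀ + 1 ≤ k₁ := by
        by_contra h; exact hk₁ (hlow k₁ (by omega))
      -- the resonance datum: `Im ω = (s − 1 − i₀)κ₁`
      have hres' : 2 * etaEvent M a Λ ω m - (s : ℂ) + 1 + ((i₀ : ℝ) : ℂ) = 0 := by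
        rw [Complex.ofReal_natCast]
        have h := hi₀
        simp only [hρdef, hη₁] at h
        linear_combination h
      have hyp := im_of_eventRay_resonance hsub hray hres'
      -- the stratum is doubly resonant with `u < s − 1 − i₀`: `a ≠ 0`, `m = 0`, `ω = iy`
      set u : ℝ := (j : ℝ) - s with hudef
      have hyc' : ω.im = u * surfaceGravity M a Λ (rCosmo M a Λ) := hyc
      have hu : 0 < u := (pos_iff_pos_of_mul_pos (hyc' ▸ hω)).2 hκ₂
      have hNr : ((D + j + 1 : ℕ) : ℝ) = (N : ℝ) := by rw [hDj]
      push_cast at hNr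
      have huv : u < s - 1 - (i₀ : ℝ) := by
        have h2 : (i₀ : ℝ) + 1 ≤ (k₁ : ℝ) := by exact_mod_cast hk₁i
        have h3 : (k₁ : ℝ) ≤ (D : ℝ) := by exact_mod_cast hk₁D
        rw [hudef]; linarith
      have ha' : a ≠ 0 := a_ne_zero_of_resonance hsub hu huv hyc' hyp
      have hm0 : m = 0 :=
        eq_zero_of_two_rays hsub (lt_of_le_of_ne ha (Ne.symm ha')) hray hray₂
      have hωI : ω = I * ((ω.im : ℝ) : ℂ) := by
        apply Complex.ext <;> simp [hray, hm0]
      -- the degree and the candidate polynomial: `r = X^{i₀+1}·ũ`, `ũ ≠ 0`, `deg ũ ≤ d`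
      set d : ℕ := D - 1 - i₀ with hddef
      have hdD : d + (i₀ + 1) = D := by omega
      have hd : (d : ℝ) = s - 2 - (i₀ : ℝ) - u := by
        have h2 : ((d + (i₀ + 1) : ℕ) : ℝ) = (D : ℝ) := by rw [hdD]
        push_cast at h2
        rw [hudef]; linarith
      have hc₀ne : c₀ ≠ 0 := eulerKernel_ne_zero _ _
      have hAlow : ∀ k, k < i₀ + 1 → A.coeff k = 0 := fun k hk =>
        (mul_eq_zero.mp (hlow k hk)).resolve_left hc₀ne
      have hrlow : ∀ k, k < i₀ + 1 → r.coeff k = 0 :=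
        coeff_eq_zero_of_shiftPoly_coeff_eq_zero hzr0.ne' (by omega) hAlow
      obtain ⟨ut, hrut⟩ : X ^ (i₀ + 1) ∣ r := Polynomial.X_pow_dvd_iff.mpr hrlow
      have hut : ut ≠ 0 := by
        intro hut0
        apply hk₁
        have hr0 : r = 0 := by rw [hrut, hut0, mul_zero]
        simp only [haC, hAdef, hr0, shiftPoly_zero, coeff_zero, mul_zero]
      have hutdeg : ut.natDegree ≤ d := by
        rw [Polynomial.natDegree_le_iff_coeff_eq_zero]
        intro n hn
        have hn' : d < n := by exact_mod_cast hn
        rw [← coeff_X_pow_mul ut (i₀ + 1) n, ← hrut]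
        exact coeff_eq_zero_of_natDegree_lt (by omega)
      -- pass to `(ω, m) = (iy, 0)` and apply T10 (`RouteWDoublyResonantCandidate`)
      have hysol' := hysol
      rw [hωI, hm0] at hysol'
      have hyr' := hyr
      rw [hrut, hωI, hm0] at hyr'
      have hpos := im_lambdaBar_mul_conj_pos_of_hatsuda hsub ha' hu hyc' hyp hd hysol' hut hutdeg
        hyr'
      have hlam' := hlam
      rw [hωI, hm0] at hlam'
      linarith
    · -- no resonance: no weight vanishes (as in `radial_vanishing_lattice`)
      push Not at hres
      intro k
      by_cases hk : k < D + 1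
      · exact eq_zero_of_partnerCoeff_eq_zero hres h2 (hb0 k hk)
      · exact haC0 k (by omega)
  -- (6) `v ≡ 0` on `(1, z₂)`, hence `R ≡ 0` on `(r₊, r_c)`
  have hv0 : ∀ w ∈ Ioo 1 z₂, mobiusV zr η y w = 0 := by
    intro w hw
    rw [hv_eq w hw]
    unfold cpowSum
    exact sum_eq_zero fun k _ => by rw [ha0 k, zero_mul]
  intro rr hr
  have hx := mobiusZ_mem_Ioo hsub hr
  set x := mobiusZ M a Λ rr with hxdef
  obtain ⟨hx0, hx1⟩ := hx
  have hzx : 0 < zr - x := by linarith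
  have hw1 : 1 < zr / (zr - x) := by rw [lt_div_iff₀ hzx]; linarith
  have hw2 : zr / (zr - x) < z₂ := by
    rw [← hA', div_lt_div_iff_of_pos_left hzr0 hzx (by linarith)]
    linarith
  have hX : mobiusX zr (zr / (zr - x)) = x := by
    unfold mobiusX
    field_simp
    ring
  have h0 := hv0 _ ⟨hw1, hw2⟩
  simp only [mobiusV] at h0
  rw [hX] at h0
  rcases mul_eq_zero.mp h0 with hk | hyx
  · exact absurd hk (eulerKernel_ne_zero _ _)
  · have hrm : rr ≠ rMinus M a Λ := by
      intro h; rw [h] at hr; exact absurd hr.1 (by linarith)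
    have hinv := mobiusInv_mobiusZ hsub hrm
    simp only [hy, hxdef] at hyx
    rw [hinv] at hyx
    rcases div_eq_zero_iff.mp hyx with hR0 | hw0
    · exact hR0
    · exact absurd hw0 (heunWeight_ne_zero hsub s ω m hr)

/-! ### The typed residual is a theorem -/

/-- ★ **`RouteW.NonExtremeStrata` holds** (STRUCTURE §8 Q3: CTdC Prop. 3.8's pair condition `p₁`
is NOT needed for its conclusion, for the generic-bullet boundary predicates as typed). On the
residual set (`s > 2`, lattice) split on the event threshold ray: off it
`radial_vanishing_lattice`, on it `radial_vanishing_lattice_eventRay`. PROVED, 0 cited facts. -/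
theorem nonExtremeStrata_holds : NonExtremeStrata := by
  intro M a Λ s ω m lam R hsub ha h2s hω hle hoff hlam hSR hp₃ hR hin hout
  have hs2 : 2 < s := two_lt_of_nonExtreme hsub hω hle
  obtain ⟨k, hk⟩ := h2s
  have hk1 : (1 : ℤ) ≤ k := by exact_mod_cast (show (1 : ℝ) ≤ (k : ℝ) by rw [← hk]; linarith)
  obtain ⟨N, hNk⟩ : ∃ N : ℕ, (N : ℤ) = k := ⟨k.toNat, Int.toNat_of_nonneg (by omega)⟩
  have hsN : 2 * s = (N : ℝ) := by rw [hk]; exact_mod_cast hNk.symm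
  have hN1 : 1 ≤ N := by exact_mod_cast (hNk ▸ hk1 : (1 : ℤ) ≤ (N : ℤ))
  -- on the lattice: `s + 2B(r_c) = j`, `1 ≤ j ≤ N − 1`
  obtain ⟨j, hj, hj'⟩ : ∃ j : ℤ, (j : ℝ) ≤ 2 * s - 1 ∧
      (s : ℂ) + 2 * horizonB M a Λ ω m (rCosmo M a Λ) = j := by
    by_contra h
    exact hoff fun j hj hj' => h ⟨j, hj, hj'⟩
  have hκ₂ := surfaceGravity_rCosmo_pos hsub
  have hre := congrArg Complex.re hj'
  rw [horizonB_rCosmo_eq_neg_etaCosmo hsub] at hre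
  simp [etaCosmo_re] at hre
  have hquot : 0 < ω.im / (2 * surfaceGravity M a Λ (rCosmo M a Λ)) := div_pos hω (by positivity)
  have hj0 : (0 : ℝ) < j := by linarith
  obtain ⟨j₀, hj₀⟩ : ∃ j₀ : ℕ, (j₀ : ℤ) = j :=
    ⟨j.toNat, Int.toNat_of_nonneg (by exact_mod_cast hj0.le)⟩
  have hj₀N : j₀ + 1 ≤ N := by
    have h1 : ((j₀ : ℤ) : ℝ) ≤ 2 * s - 1 := by rw [hj₀]; exact hj
    have h2 : (j₀ : ℝ) + 1 ≤ (N : ℝ) := by push_cast at h1; linarith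
    exact_mod_cast h2
  have hlat : (s : ℂ) + 2 * horizonB M a Λ ω m (rCosmo M a Λ) = (j₀ : ℂ) := by
    rw [hj']
    have : ((j : ℤ) : ℂ) = ((j₀ : ℕ) : ℂ) := by rw [← hj₀]; norm_cast
    exact this
  by_cases hray : ω.re = m * horizonAngVel a (rPlus M a Λ)
  · exact radial_vanishing_lattice_eventRay hsub ha hN1 hsN hω hlam hSR hp₃ hray hj₀N hlat hR hin
      hout
  · exact radial_vanishing_lattice hsub ha hN1 hsN hω hlam hSR hp₃ hray hj₀N hlat hR hin hout

/-- **H3 without `p₁`.** The conclusion of `CasalsTeixeiraDaCosta2022_partialModeStabilityProp38`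
for every `s ∈ ½ℤ` under its binders subextremal, `0 ≤ a`, `Im ω > 0`, `Im(λ̄ω̄) ≤ 0`,
`|ω| ∉ |m|(0,Ω_SR)` and the pair condition `p₃` for `−2(η₁+η₀)` ONLY — the pair condition `p₁`
for `s − 2η₁` of `prop38_allSpins` is dropped (above `(s−2)κ₂`: `prop38_of_im_gt_pred_cosmo`;
off the lattice: `prop38_of_im_gt_or_offLattice`; the residual: `nonExtremeStrata_holds`).
PROVED, 0 cited facts. -/
theorem prop38_without_p₁ (M a Λ s : ℝ) (ω : ℂ) (m : ℝ) (lam : ℂ)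
    (hsub : IsSubextremal M a Λ) (ha : 0 ≤ a) (h2s : ∃ k : ℤ, 2 * s = k) (hω : 0 < ω.im)
    (hlam : (lambdaBar a Λ s ω m lam * (starRingEnd ℂ) ω).im ≤ 0)
    (hSR : ¬(0 < ‖ω‖ ∧ ‖ω‖ < |m| * superradiantUpper M a Λ))
    (hp₃ : PairCondition (-2 * (etaEvent M a Λ ω m + etaCauchy M a Λ ω m)))
    (R : ℝ → ℂ) (hR : IsRadialTeukolskySolution M a Λ s ω m lam R)
    (hin : IsIngoingAtEventHorizon M a Λ s ω m R) (hout : IsOutgoingAtCosmoHorizon M a Λ ω m R) :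
    ∀ r ∈ Ioo (rPlus M a Λ) (rCosmo M a Λ), R r = 0 := by
  by_cases hhi : (s - 2) * surfaceGravity M a Λ (rCosmo M a Λ) < ω.im
  · exact prop38_of_im_gt_pred_cosmo M a Λ s ω m lam hsub ha h2s hω hhi hlam hSR hp₃ R hR hin hout
  · by_cases hoff : OffLattice M a Λ s ω m
    · exact prop38_of_im_gt_or_offLattice M a Λ s ω m lam hsub ha h2s hω hlam hSR hp₃ (Or.inr hoff)
        R hR hin hout
    · exact nonExtremeStrata_holds M a Λ s ω m lam R hsub ha h2s hω (not_lt.mp hhi) hoff hlam hSR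
        hp₃ hR hin hout

end RouteW

end Summit.Ventures.KdS
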